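import Summits.Ventures.PercRepro.RankLevelSetRuleQStaircaseTen
import Summits.Ventures.PercRepro.RankLevelSetRuleQSevenWhole
import Summits.Ventures.PercRepro.RankLevelSetRuleQCellSmallK

/-!
# PercRepro — THE COMPLETE SLICE MAP OF RULE Q ON THE CELL FAMILIES `k ≤ 7`: EVERY SLICE `u = q − #P`, EVERY `q`
(night-1, gen 19; dossier §30)

The thin-slice maps of the families `k = 5, 6, 7` (night-1 g18: `rhat_five/six/seven_slice_iff_ten`, exact for `u ≤ 10`) lose
their bound on `u` once the whole untruncated regime `u ≥ k − 1` of each family is a theorem for every `q`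
(p4 g24: `rhat_five_whole`, `rhat_six_whole`, `rhat_seven_whole` — `Φ(q+k, q) ≤ R̂(q, k, m)` whenever `m + (k−1) ≤ q`);
with p4's `rhatCell_of_le_four` (every slice of every cell of the families `k ≤ 4`) the map of Rule Q's equal split on the
families `2 ≤ k ≤ 7` is complete and exact, with NO restriction on the slice:
* **`rhat_five_slice_iff_all`** — the slice `u` of the family `k = 5` is paid on EVERY cell `(q+5, q)` iff `u ≠ 2`;
* **`rhat_six_slice_iff_all`** — `k = 6`: iff `u ∉ {2, 3}`; **`rhat_seven_slice_iff_all`** — `k = 7`: iff `u ∉ {2, 3, 4}`;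
* **`rhat_slice_iff_all`** — uniformly for `5 ≤ k ≤ 7`: iff `u ∉ [2, k − 3]`;
* **`rhat_slice_iff_le_seven`** — for `2 ≤ k ≤ 7`: the slice `u` is paid on every cell iff `k ≤ 4 ∨ u < 2 ∨ k − 2 ≤ u`;
* **`rhat_ge_phiK_of_slice`** — the positive half in the `m = #P` spelling, and **`ruleQRecv_ge_phiK_of_slice`** — the matroid
  level: at the tight layer of every finite matroid of a cell `(q+k, q)`, `5 ≤ k ≤ 7`, every member `Z` whose complementary
  basis meets `cl Z` in `#P = q − u` elements with `u ∉ [2, k − 3]` receives at least `Φ(q+k, q)` under Rule Q's equal split —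
  the deficit of the equal split on these families is confined to the `k − 4` slices `2 ≤ q − #P ≤ k − 3`.
Axioms: standard.
-/

namespace PercRepro

open Finset

/-- **The family `k = 5`, every slice**: Rule Q's equal split pays the slice `u = q − #P` on EVERY cell `(q+5, q)` if and only if
`u ≠ 2` (`u ≤ 10`: `rhat_five_slice_iff_ten`; `u ≥ 4`: p4's `rhat_five_whole`). -/
theorem rhat_five_slice_iff_all (u : ℕ) :
    (∀ q, u ≤ q → phiK (q + 5) q ≤ rhat q 5 (q - u)) ↔ u ≠ 2 := by
  constructor
  · intro h hu2
    subst hu2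
    exact (rhat_five_slice_iff_ten 2 (by norm_num)).1 h rfl
  · intro hu2 q hq
    rcases Nat.lt_or_ge u 4 with hlt | hge
    · exact (rhat_five_slice_iff_ten u (by omega)).2 hu2 q hq
    · exact rhat_five_whole q (q - u) (by omega)

/-- **The family `k = 6`, every slice**: paid on EVERY cell `(q+6, q)` iff `u ∉ {2, 3}`. -/
theorem rhat_six_slice_iff_all (u : ℕ) :
    (∀ q, u ≤ q → phiK (q + 6) q ≤ rhat q 6 (q - u)) ↔ (u ≠ 2 ∧ u ≠ 3) := by
  constructor
  · intro h
    refine ⟨fun hu2 => ?_, fun hu3 => ?_⟩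
    · subst hu2
      exact ((rhat_six_slice_iff_ten 2 (by norm_num)).1 h).1 rfl
    · subst hu3
      exact ((rhat_six_slice_iff_ten 3 (by norm_num)).1 h).2 rfl
  · rintro ⟨hu2, hu3⟩ q hq
    rcases Nat.lt_or_ge u 5 with hlt | hge
    · exact (rhat_six_slice_iff_ten u (by omega)).2 ⟨hu2, hu3⟩ q hq
    · exact rhat_six_whole q (q - u) (by omega)

/-- **The family `k = 7`, every slice**: paid on EVERY cell `(q+7, q)` iff `u ∉ {2, 3, 4}`. -/
theorem rhat_seven_slice_iff_all (u : ℕ) :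
    (∀ q, u ≤ q → phiK (q + 7) q ≤ rhat q 7 (q - u)) ↔ (u ≠ 2 ∧ u ≠ 3 ∧ u ≠ 4) := by
  constructor
  · intro h
    refine ⟨fun hu2 => ?_, fun hu3 => ?_, fun hu4 => ?_⟩
    · subst hu2
      exact ((rhat_seven_slice_iff_ten 2 (by norm_num)).1 h).1 rfl
    · subst hu3
      exact ((rhat_seven_slice_iff_ten 3 (by norm_num)).1 h).2.1 rfl
    · subst hu4
      exact ((rhat_seven_slice_iff_ten 4 (by norm_num)).1 h).2.2 rfl
  · rintro ⟨hu2, hu3, hu4⟩ q hq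
    rcases Nat.lt_or_ge u 6 with hlt | hge
    · exact (rhat_seven_slice_iff_ten u (by omega)).2 ⟨hu2, hu3, hu4⟩ q hq
    · exact rhat_seven_whole q (q - u) (by omega)

/-- **THE SLICE MAP OF THE FAMILIES `5 ≤ k ≤ 7`, COMPLETE AND EXACT**: Rule Q's equal split pays the slice `u = q − #P` on
EVERY cell `(q+k, q)` if and only if `u ∉ [2, k − 3]`. -/
theorem rhat_slice_iff_all (k u : ℕ) (hk5 : 5 ≤ k) (hk7 : k ≤ 7) :
    (∀ q, u ≤ q → phiK (q + k) q ≤ rhat q k (q - u)) ↔ (u < 2 ∨ k - 2 ≤ u) := by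
  interval_cases k
  · rw [rhat_five_slice_iff_all u]; omega
  · rw [rhat_six_slice_iff_all u]; omega
  · rw [rhat_seven_slice_iff_all u]; omega

/-- **The families `k ≤ 4`, every slice** (p4's `rhatCell_of_le_four`, with the top slice `u = q = 0` by `rhatCell_self`). -/
theorem rhat_slice_of_le_four (k u : ℕ) (hk2 : 2 ≤ k) (hk4 : k ≤ 4) (q : ℕ) (hq : u ≤ q) :
    phiK (q + k) q ≤ rhat q k (q - u) := by
  rcases Nat.eq_zero_or_pos q with hq0 | hq1
  · subst hq0
    have hu : u = 0 := by omega
    subst hu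
    exact rhatCell_self 0 k hk2
  · exact rhatCell_of_le_four q k hq1 hk2 hk4 (q - u) (Nat.sub_le q u)

/-- **THE SLICE MAP OF RULE Q ON EVERY FAMILY `2 ≤ k ≤ 7`**: the slice `u = q − #P` is paid on every cell `(q+k, q)` if and
only if `k ≤ 4`, or `u ≤ 1`, or `u ≥ k − 2` — Rule Q's equal split is universal exactly on the families `k ≤ 4`, and on
`k = 5, 6, 7` it fails exactly on the `k − 4` slices `2 ≤ u ≤ k − 3`. -/
theorem rhat_slice_iff_le_seven (k u : ℕ) (hk2 : 2 ≤ k) (hk7 : k ≤ 7) :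
    (∀ q, u ≤ q → phiK (q + k) q ≤ rhat q k (q - u)) ↔ (k ≤ 4 ∨ u < 2 ∨ k - 2 ≤ u) := by
  rcases Nat.lt_or_ge k 5 with hlt | hge
  · exact ⟨fun _ => Or.inl (by omega), fun _ q hq => rhat_slice_of_le_four k u hk2 (by omega) q hq⟩
  · rw [rhat_slice_iff_all k u hge hk7]
    omega

/-- **The positive half in the `m = #P` spelling**: for `5 ≤ k ≤ 7` and `m ≤ q`, `Φ(q+k, q) ≤ R̂(q, k, m)` whenever
`q − m ≤ 1` or `q − m ≥ k − 2`. -/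
theorem rhat_ge_phiK_of_slice (k q m : ℕ) (hk5 : 5 ≤ k) (hk7 : k ≤ 7) (hm : m ≤ q)
    (hu : q < m + 2 ∨ m + (k - 2) ≤ q) :
    phiK (q + k) q ≤ rhat q k m := by
  have h := (rhat_slice_iff_all k (q - m) hk5 hk7).2 (by omega) q (Nat.sub_le q m)
  rwa [Nat.sub_sub_self hm] at h

variable {α : Type} (M : Matroid α) [M.Finite]

/-- **The matroid level**: at the tight layer `#E = (q+k) + q` of a cell `(q+k, q)` with `5 ≤ k ≤ 7`, every member `Z` with
`#(flatPart M Z) = q − u` and `u ∉ [2, k − 3]` receives at least `Φ(q+k, q)` under Rule Q's equal split (`rhat_le_ruleQRecv`). -/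
theorem ruleQRecv_ge_phiK_of_slice {q k u : ℕ} (hk5 : 5 ≤ k) (hk7 : k ≤ 7) (hu : u < 2 ∨ k - 2 ≤ u) (hq : u ≤ q)
    (hE : M.E.ncard = (q + k) + q) {Z : Set α} (hZ : Z ∈ cellMembers M (q + k) q)
    (hP : (flatPart M Z).ncard = q - u) :
    phiK (q + k) q ≤ ruleQRecv M (q + k) q Z := by
  have h1 := (rhat_slice_iff_all k u hk5 hk7).2 hu q hq
  have h2 := rhat_le_ruleQRecv M hE hZ
  rw [hP] at h2
  exact h1.trans h2

/-- **The matroid level in the `#P` spelling**: at the tight layer of a cell `(q+k, q)`, `5 ≤ k ≤ 7`, a member `Z` whose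
complementary basis meets `cl Z` in `m` elements with `q − m ≤ 1` or `q − m ≥ k − 2` is paid by Rule Q's equal split. -/
theorem ruleQRecv_ge_phiK_of_flatPart {q k : ℕ} (hk5 : 5 ≤ k) (hk7 : k ≤ 7)
    (hE : M.E.ncard = (q + k) + q) {Z : Set α} (hZ : Z ∈ cellMembers M (q + k) q)
    (hm : (flatPart M Z).ncard ≤ q)
    (hu : q < (flatPart M Z).ncard + 2 ∨ (flatPart M Z).ncard + (k - 2) ≤ q) :
    phiK (q + k) q ≤ ruleQRecv M (q + k) q Z :=
  (rhat_ge_phiK_of_slice k q _ hk5 hk7 hm hu).trans (rhat_le_ruleQRecv M hE hZ)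

end PercRepro
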